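import Summits.Langlands.Langlands.Theses.RootDecomp1
import Summits.Langlands.Langlands.Theorems.PicardMuOrdinaryMuOrdinaryFamilyRTDictionary
import Summits.Langlands.Langlands.Theorems.IrreducibilityBySelfDualityReciprocityUpToIrreducibilityWeakExistence
import Summits.Langlands.Langlands.Theorems.IrreducibilityBySelfDualityVarmaWeilTracesUnramified
import Literature.NumberTheory.Automorphic.HarishChandraFinitenessGL
import Literature.NumberTheory.Automorphic.LocalComponentBJExistsProofs
import Literature.NumberTheory.Automorphic.AdicCompletionResidueCard
import Literature.NumberTheory.Automorphic.CarayolCompatibilityOfLocalGlobalProofs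
import Literature.NumberTheory.Automorphic.GLnUnramifiedLFactorDivisibility
import Literature.NumberTheory.Automorphic.LocalComponentBJGenericProofs
import Literature.NumberTheory.Automorphic.LocalComponentBJSatakeProofs
import Literature.NumberTheory.Automorphic.SatakeParametersGLProofs
import Literature.NumberTheory.Automorphic.AutomorphicRepsGLOneHeckeCharacter
import Literature.NumberTheory.Automorphic.ReciprocityGLnRankOneProofs
import Literature.NumberTheory.Automorphic.LocalLanglandsGLOne
import Literature.NumberTheory.Automorphic.LocalLanglandsDatum
import Literature.NumberTheory.Automorphic.HeckeCharacterLocalComponentSmooth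
import Literature.NumberTheory.Automorphic.AutomorphicTwistSatake
import Literature.NumberTheory.GaloisRepresentations.WeilDeligneRep
import Literature.NumberTheory.GaloisRepresentations.WeilDeligneOfGaloisUnramifiedProofs
import Literature.NumberTheory.GaloisRepresentations.WeilDeligneRepFrobSemisimpleProofs
import Literature.NumberTheory.GaloisRepresentations.DecompositionGroupOfCompletion
import Literature.NumberTheory.GaloisRepresentations.LocalGaloisGroupProofs
import Literature.NumberTheory.GaloisRepresentations.LocalGaloisGroupFrobeniusProofs
import Literature.NumberTheory.GaloisRepresentations.InertiaCharacter
import Literature.NumberTheory.GaloisRepresentations.UnramifiedDatum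
import Literature.NumberTheory.GaloisRepresentations.WeilGroupFrobeniusPowers
import Literature.NumberTheory.GaloisRepresentations.LAdicRepFrobenius
import Literature.NumberTheory.GaloisRepresentations.FramedRepEquivConj
import Literature.RepresentationTheory.Semisimple.EquivOfCharacter
import Literature.RepresentationTheory.FiniteGroups.TracePowCharpoly
import Literature.AlgebraicGeometry.Motives.FaltingsECSemisimpleNumberFieldProofs
import HarnessLib

/-!
# `RootDecomp1.SatakePlacesAllData` — proof twin, part 1/3 (LOCAL bookkeeping at `v ∤ ℓ`)

Helpers (`_spad` re-derivations, all mathematics already in the tree, NO named fact) for the proof of the support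
leaf `Summit.Langlands.Langlands.Theses.RootDecomp1.SatakePlacesAllData` (item stmt-Langlands-23602), landed in
`Theorems/RootDecomp1SatakePlacesAllData.lean` (part 3/3).  This part: polynomial bookkeeping `∏ (1 - aX)` vs
`∏ (X - a)`; unramified Weil–Deligne parameters and `rec_v` of an unramified `π_v` (Carayol's deduction from the
local Langlands datum).  The five bookkeeping lemmas that restate the landed `ReciprocityUpToIrreducibility.*_recGLn`
declarations (module `…RecGLUnramified`, no hub olean, hence not importable here) are `private` (gate dedup.landed;
used only in this file).  Source: lens-1 g27 kernel twin (sha256 03b6ede1a139d5ff, 794 l, rc 0 · axioms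
standard), split ≤ 400 lines per file by decomp-langlands-writer-1 g8 (critic row 329 landing advisory).

## References

* H. Carayol, Ann. Sci. ÉNS 19 (1986), Thm. (A). [CarayolASENS1986]
* J. Tate, *Number theoretic background*, Corvallis 1979, (1.4.1)–(1.4.6), (4.1.2)–(4.2.1). [TateCorvallis1979]
* N. Bourbaki, *Algèbre* VIII (2012), § 20 n° 6. [BourbakiAlgebreVIII2012]
* M. Harris, R. Taylor, Ann. of Math. Stud. 151 (2001), Thm. A. [HarrisTaylorAMS2001]
-/

noncomputable section

set_option linter.dupNamespace false -- project-wide option (lakefile weak.linter.dupNamespace); `Summit.Langlands.Langlands` is the mandated namespace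

open scoped MatrixGroups Matrix NumberField Classical Polynomial
open Filter IsDedekindDomain Field Polynomial MeasureTheory
open Literature.NumberTheory.Automorphic Literature.NumberTheory.GaloisRepresentations
open Literature.NumberTheory.PAdicHodge
open Summit.Langlands
open Summit.Langlands.Langlands.Theorems.VarmaWeilTracesUnramified
open Summit.Langlands.Langlands.Theorems.ReciprocityUpToIrreducibility


namespace Summit.Langlands.Langlands.Theorems

namespace SatakePlacesAllDataProof

open Literature.NumberTheory.EllipticCurves.Hida2000Thm326 (exists_haar_measure_quotient_fin_one)

/-! ### Polynomial bookkeeping: `∏ (1 - a X)` versus `∏ (X - a)` -/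

/-- `deg ∏_{a ∈ α} (1 - a X) ≤ card α` and `reflect (card α) ∏_{a ∈ α} (1 - a X) = ∏_{a ∈ α} (X - a)`.
[folklore] -/
private theorem reflect_card_prod_one_sub_C_mul_X_spad (α : Multiset ℂ) :
    ((α.map fun a => (1 : ℂ[X]) - C a * X).prod).natDegree ≤ Multiset.card α ∧
      reflect (Multiset.card α) ((α.map fun a => (1 : ℂ[X]) - C a * X).prod) =
        (α.map fun a => X - C a).prod := by
  -- copy of `Literature.NumberTheory.Automorphic.reflect_card_prod_one_sub_C_mul_X_gl`
  induction α using Multiset.induction_on with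
  | empty => simp
  | cons a s ih =>
    obtain ⟨hdeg, hrefl⟩ := ih
    have h1 : ((1 : ℂ[X]) - C a * X).natDegree ≤ 1 :=
      (natDegree_sub_le _ _).trans (max_le (by simp) ((natDegree_C_mul_le a X).trans natDegree_X_le))
    simp only [Multiset.map_cons, Multiset.prod_cons, Multiset.card_cons]
    refine ⟨natDegree_mul_le.trans (by omega), ?_⟩
    rw [add_comm, reflect_mul _ _ h1 hdeg, hrefl, reflect_sub, reflect_one, pow_one, reflect_C_mul,
      reflect_one_X, mul_one]

/-- `deg ∏_{a ∈ α} (1 - a X) = card α` when no `a` vanishes. [folklore] -/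
private theorem natDegree_prod_one_sub_C_mul_X_spad {α : Multiset ℂ} (h : ∀ a ∈ α, a ≠ 0) :
    ((α.map fun a => (1 : ℂ[X]) - C a * X).prod).natDegree = Multiset.card α := by
  -- copy of `Literature.NumberTheory.Automorphic.natDegree_prod_one_sub_C_mul_X_gl`
  induction α using Multiset.induction_on with
  | empty => simp
  | cons a s ih =>
    have ha : a ≠ 0 := h a (Multiset.mem_cons_self a s)
    have hs := ih fun b hb => h b (Multiset.mem_cons_of_mem hb)
    have h1 : ((1 : ℂ[X]) - C a * X).natDegree = 1 := by
      rw [natDegree_sub_eq_right_of_natDegree_lt] <;> rw [natDegree_C_mul_X _ ha]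
      simp
    have h1' : ((1 : ℂ[X]) - C a * X) ≠ 0 := fun h0 => by simpa using congrArg (eval 0) h0
    have hs' : (s.map fun a => (1 : ℂ[X]) - C a * X).prod ≠ 0 := fun h0 => by
      simpa [eval_multiset_prod] using congrArg (eval 0) h0
    simp only [Multiset.map_cons, Multiset.prod_cons, Multiset.card_cons]
    rw [natDegree_mul h1' hs', h1, hs, add_comm]

/-- A polynomial of degree `card α` whose reverse is `∏_{a ∈ α} (1 - a X)` is `∏_{a ∈ α} (X - a)`.
[folklore] -/
private theorem eq_prod_X_sub_C_of_reverse_eq_spad {p : ℂ[X]} {α : Multiset ℂ}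
    (hdeg : p.natDegree = Multiset.card α)
    (hrev : p.reverse = (α.map fun a => (1 : ℂ[X]) - C a * X).prod) :
    p = (α.map fun a => X - C a).prod := by
  -- copy of `Literature.NumberTheory.Automorphic.eq_prod_X_sub_C_of_reverse_eq_gl`
  rw [← (reflect_card_prod_one_sub_C_mul_X_spad α).2, ← hrev, Polynomial.reverse, hdeg, reflect_reflect]

/-! ### Weil–Deligne bookkeeping on a local field `F` -/

section Local

variable {F : Type} [Field F] [ValuativeRel F] [TopologicalSpace F] [IsNonarchimedeanLocalField F]
  {n : ℕ}

/-- If `r ≅ r'` and `r'` has `N = 0` and trivial inertia action, then so does `r`, and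
`char(r.ρ w) = char(r'.ρ w)` for every `w ∈ W_F`. [cite: TateCorvallis1979, (4.1.2)–(4.1.6)] -/
private theorem wd_unramified_charpoly_of_isEquivalent_spad {r r' : WeilDeligneRep F ℂ (Fin n → ℂ)}
    (h : r.IsEquivalent r') (hN : r'.N = 0) (hρ : ∀ u ∈ WeilGroup.inertia F, r'.ρ u = 1) :
    r.N = 0 ∧ WeilGroup.IsUnramifiedRep r.ρ ∧
      ∀ w : WeilGroup F, (r.ρ w).charpoly = (r'.ρ w).charpoly := by
  -- copy of `WeilDeligneRep.unramified_charpoly_of_isEquivalent_gl` (Carayol GLn Literature file)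
  obtain ⟨e'⟩ := h
  set φ' : (Fin n → ℂ) ≃ₗ[ℂ] (Fin n → ℂ) := e'.toRepEquiv.toLinearEquiv with hφ'
  have hφ'ρ : ∀ (u : WeilGroup F) (y : Fin n → ℂ), φ' (r.ρ u y) = r'.ρ u (φ' y) := fun u y => by
    rw [hφ', Representation.Equiv.toLinearEquiv_apply, Representation.Equiv.toLinearEquiv_apply]
    exact Representation.IntertwiningMap.isIntertwining _ _ e'.toRepEquiv.toIntertwiningMap u y
  have hφ'N : ∀ y : Fin n → ℂ, φ' (r.N y) = r'.N (φ' y) := fun y => LinearMap.congr_fun e'.comm_N y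
  refine ⟨?_, fun u hu => ?_, fun w => ?_⟩
  · refine LinearMap.ext fun y => φ'.injective ?_
    rw [hφ'N, hN, LinearMap.zero_apply, LinearMap.zero_apply, map_zero]
  · refine LinearMap.ext fun y => φ'.injective ?_
    rw [hφ'ρ, hρ u hu]
    rfl
  · have hconj : φ'.conj (r.ρ w) = r'.ρ w := by
      refine LinearMap.ext fun y => ?_
      simp only [LinearEquiv.conj_apply, LinearMap.comp_apply, LinearEquiv.coe_coe, hφ'ρ,
        LinearEquiv.apply_symm_apply]
    rw [← hconj, LinearEquiv.charpoly_conj]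

/-- An unramified representation of `W_F` takes the same value at any two elements of the same degree
(they differ by inertia). [cite: TateCorvallis1979, (1.4.1), (4.1.6)] -/
private theorem wd_apply_eq_of_isUnramifiedRep_of_deg_eq_spad {r : WeilDeligneRep F ℂ (Fin n → ℂ)}
    (hρ : WeilGroup.IsUnramifiedRep r.ρ) {Φ Φ' : WeilGroup F}
    (h : WeilGroup.deg Φ = WeilGroup.deg Φ') : r.ρ Φ = r.ρ Φ' := by
  -- copy of `WeilDeligneRep.apply_eq_of_isUnramifiedRep_of_deg_eq_gl` (Carayol GLn Literature file)
  have hmem : Φ * Φ'⁻¹ ∈ WeilGroup.inertia F := by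
    rw [← WeilGroup.deg_eq_zero_iff_mem_inertia IsFrobPow.mul_holds IsFrobPow.unique_holds,
      WeilGroup.deg_mul IsFrobPow.mul_holds IsFrobPow.unique_holds,
      WeilGroup.deg_inv IsFrobPow.mul_holds IsFrobPow.unique_holds, h, add_neg_cancel]
  calc r.ρ Φ = r.ρ (Φ * Φ'⁻¹ * Φ') := by rw [inv_mul_cancel_right]
    _ = r.ρ Φ' := by rw [map_mul, hρ _ hmem, one_mul]

/-! ### Carayol's deduction at a spherical generic `π_v` of `GL_n(F)`, for every datum -/

/-- **The chosen representative of `rec(π_v)` is unramified with the Satake characteristic polynomial —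
for EVERY local Langlands datum, unconditionally** (`2 ≤ n`): clause (iii-L) makes the Euler factor
`P₀` of `A₀ ⊗ rec(1)` THE JPSS `L`-polynomial of `(π_v, 1)`, of degree `≤ n`, hence `P₀ = ∏ (1 - a T)`
by the unramified divisibility; `rec(1) ≅ (1 ∘ artin, 0)` (clause (ii)); full degree gives
`(ker N)^I = A₀ ⊗ rec(1)` and `det(1 - TΦ₀ | A₀) = ∏ (1 - a T)`.
[cite: HarrisTaylorAMS2001, Thm. A (ii), (v)] [cite: TateCorvallis1979, (4.1.6)] [cite: JacquetShalika1981, §2] -/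
theorem recGL_out_unramified_of_isSatakeParameter_spad (d : LocalLanglandsDatum F) (hn : 1 < n)
    (πv : SmoothIrrep (GL (Fin n) F)) {ψ : AddChar F Circle} (hψ : ψ.IsContinuousNontrivial)
    (hgen : IsGeneric πv.ρ ψ) {ϖ : Fˣ} (hϖ : (ValuativeRel.valuation F).IsUniformizer (ϖ : F))
    {α : Multiset ℂ} (hα : IsSatakeParameter πv.ρ ϖ α) :
    ((d.recGL n (IrrClass.mk πv)).out.1).N = 0 ∧
      (∀ u ∈ WeilGroup.inertia F, ((d.recGL n (IrrClass.mk πv)).out.1).ρ u = 1) ∧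
      (((d.recGL n (IrrClass.mk πv)).out.1).ρ (WeilDeligneRep.geomFrob F d.hex)).charpoly =
        (α.map fun a => X - C a).prod := by
  -- copy of `LocalLanglandsDatum.recGL_out_unramified_of_isSatakeParameter` (Carayol GLn Literature file)
  classical
  haveI := πv.isIrreducible
  haveI hirr1 : (Representation.trivial ℂ (GL (Fin 1) F) ℂ).IsIrreducible :=
    isIrreducible_trivial_complex _
  have hadm1 : (Representation.trivial ℂ (GL (Fin 1) F) ℂ).IsAdmissible :=
    isAdmissible_trivial_complex _
  have hcard : Multiset.card α = n := hα.1
  have hne : ∀ a ∈ α, a ≠ 0 := fun a ha => IsSatakeParameter.forall_ne_zero_holds hϖ hα a ha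
  -- an invariant measure on `GL₁(F) ⧸ U₁`, finite on compacts and positive on opens
  letI : MeasurableSpace F := borel F
  haveI : BorelSpace F := ⟨rfl⟩
  letI : MeasurableSpace (GL (Fin 1) F ⧸ upperUnitriangular (Fin 1) F) := borel _
  haveI : BorelSpace (GL (Fin 1) F ⧸ upperUnitriangular (Fin 1) F) := ⟨rfl⟩
  obtain ⟨_, _, ν, hinv, hfin, hpos, -⟩ := exists_haar_measure_quotient_fin_one (F := F)
  haveI := hinv
  haveI := hfin
  haveI := hpos
  -- the trivial irreducible smooth representation of `GL₁(F)` on `ℂ`, generic for `ψ⁻¹`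
  let π' : SmoothIrrep (GL (Fin 1) F) :=
    { V := ℂ
      ρ := Representation.trivial ℂ (GL (Fin 1) F) ℂ
      isIrreducible := hirr1
      isSmooth := hadm1.isSmooth }
  have hgen' : IsGeneric π'.ρ ψ⁻¹ := isGeneric_of_fin_one _ _
  -- (iii-L): the Euler factor `P₀` of `A₀ ⊗ B₀` is a JPSS `L`-polynomial of `(π_v, 1)`
  set A₀ := (d.recGL n (IrrClass.mk πv)).out.1 with hA₀
  set B₀ := (d.recGL 1 (IrrClass.mk π')).out.1 with hB₀
  set P₀ : ℂ[X] := (A₀.tprod B₀).eulerFactor d.hn d.hex with hP₀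
  have hRS : HasRSLFactor hn πv.ρ π'.ρ ψ ν P₀ :=
    (d.isLocalLanglands.lFactor_pairs Nat.one_pos hn πv π' ψ hψ hgen hgen' ν P₀).mpr hP₀
  -- `deg P₀ ≤ dim (A₀ ⊗ B₀) = n`, so `P₀ = ∏ (1 - a T)` by the unramified divisibility
  have hfr : Module.finrank ℂ (TensorProduct ℂ (Fin n → ℂ) (Fin 1 → ℂ)) = n := by
    rw [Module.finrank_tensorProduct, Module.finrank_fin_fun, Module.finrank_fin_fun, mul_one]
  have hdegle : P₀.natDegree ≤ n :=
    (natDegree_eulerFactor_le _ d.hn d.hex).trans ((Submodule.finrank_le _).trans hfr.le)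
  have hPeq : P₀ = (α.map fun a => (1 : ℂ[X]) - C a * X).prod :=
    prod_one_sub_C_mul_X_eq_of_hasRSLFactor_of_natDegree_le_gl πv.ρ hn hψ hgen hϖ hα ν hRS hdegle
  have hDdeg : ((α.map fun a => (1 : ℂ[X]) - C a * X).prod).natDegree = n := by
    rw [natDegree_prod_one_sub_C_mul_X_spad hne, hcard]
  -- (ii): `B₀ ≅ (1 ∘ artin, 0)`, so `B₀.N = 0` and `B₀.ρ = 1`
  have hgl : B₀.IsEquivalent (WeilDeligneRep.ofQuasiChar d.hns d.artin 1) :=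
    d.isLocalLanglands.gl_one 1 π' fun g v => by simp [π']
  obtain ⟨e⟩ := hgl
  set φ : (Fin 1 → ℂ) ≃ₗ[ℂ] ℂ := e.toRepEquiv.toLinearEquiv with hφ
  have hφρ : ∀ (u : WeilGroup F) (y : Fin 1 → ℂ),
      φ (B₀.ρ u y) = (WeilDeligneRep.ofQuasiChar d.hns d.artin 1).ρ u (φ y) := fun u y => by
    rw [hφ, Representation.Equiv.toLinearEquiv_apply, Representation.Equiv.toLinearEquiv_apply]
    exact Representation.IntertwiningMap.isIntertwining _ _ e.toRepEquiv.toIntertwiningMap u y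
  have hφN : ∀ y : Fin 1 → ℂ, φ (B₀.N y) = (WeilDeligneRep.ofQuasiChar d.hns d.artin 1).N (φ y) :=
    fun y => LinearMap.congr_fun e.comm_N y
  have hBρ : ∀ (u : WeilGroup F) (y : Fin 1 → ℂ), B₀.ρ u y = y := by
    intro u y
    apply φ.injective
    rw [hφρ, WeilDeligneRep.ofQuasiChar_ρ_apply]
    simp
  have hBN : B₀.N = 0 := by
    refine LinearMap.ext fun y => φ.injective ?_
    rw [hφN, WeilDeligneRep.ofQuasiChar_N, LinearMap.zero_apply, LinearMap.zero_apply, map_zero]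
  -- the Euler factor has degree `n = dim (A₀ ⊗ B₀)`, so `(ker N)^I` is everything
  have hPdeg : P₀.natDegree = n := by rw [hPeq, hDdeg]
  have htop : (A₀.tprod B₀).inertiaInvariantsKerN = ⊤ :=
    inertiaInvariantsKerN_eq_top_of_natDegree_eulerFactor_eq _ d.hn d.hex (hPdeg.trans hfr.symm)
  obtain ⟨hAN, hAρ⟩ := N_eq_zero_and_inertia_trivial_of_tprod_eq_top A₀ B₀ hBN hBρ htop
  -- the Euler factor is the reversed characteristic polynomial of `A₀.ρ Φ₀`
  have hrev : (A₀.ρ (WeilDeligneRep.geomFrob F d.hex)).charpoly.reverse =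
      (α.map fun a => (1 : ℂ[X]) - C a * X).prod := by
    rw [← charpoly_tprod_ρ_eq A₀ B₀ hBρ (WeilDeligneRep.geomFrob F d.hex),
      ← eulerFactor_eq_reverse_charpoly_of_eq_top _ d.hn d.hex htop, ← hP₀, hPeq]
  refine ⟨hAN, hAρ, eq_prod_X_sub_C_of_reverse_eq_spad ?_ hrev⟩
  rw [LinearMap.charpoly_natDegree, Module.finrank_fin_fun, hcard]

/-- **Every Frobenius-semisimple representative of `rec(π_v)` is unramified with the Satake
characteristic polynomial at every geometric Frobenius — for EVERY local Langlands datum** (`2 ≤ n`).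
[cite: CarayolASENS1986, Thm. (A)] [cite: HarrisTaylorAMS2001, Thm. A (ii), (v)] [cite: TateCorvallis1979, (4.1.6)] -/
theorem recGL_unramified_of_isSatakeParameter_spad (d : LocalLanglandsDatum F) (hn : 1 < n)
    (πv : SmoothIrrep (GL (Fin n) F)) {ψ : AddChar F Circle} (hψ : ψ.IsContinuousNontrivial)
    (hgen : IsGeneric πv.ρ ψ) {ϖ : Fˣ} (hϖ : (ValuativeRel.valuation F).IsUniformizer (ϖ : F))
    {α : Multiset ℂ} (hα : IsSatakeParameter πv.ρ ϖ α)
    (A : WeilDeligneRep F ℂ (Fin n → ℂ)) (hA : A.IsFrobSemisimple)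
    (hrec : d.recGL n (IrrClass.mk πv) = Quotient.mk (frobSemisimpleWDSetoid F n) ⟨A, hA⟩) :
    A.N = 0 ∧ WeilGroup.IsUnramifiedRep A.ρ ∧
      ∀ Φ : WeilGroup F, WeilGroup.deg Φ = -1 →
        (A.ρ Φ).charpoly = (α.map fun a => X - C a).prod := by
  -- copy of `LocalLanglandsDatum.recGL_unramified_of_isSatakeParameter` (Carayol GLn Literature file)
  obtain ⟨hAN, hAρ, hch⟩ := recGL_out_unramified_of_isSatakeParameter_spad d hn πv hψ hgen hϖ hα
  have hAA : ((d.recGL n (IrrClass.mk πv)).out.1).IsEquivalent A :=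
    Quotient.exact ((Quotient.out_eq _).trans hrec)
  obtain ⟨hN, hur, hchar⟩ := wd_unramified_charpoly_of_isEquivalent_spad hAA.symm hAN hAρ
  refine ⟨hN, hur, fun Φ hΦ => ?_⟩
  rw [wd_apply_eq_of_isUnramifiedRep_of_deg_eq_spad hur
      (hΦ.trans (WeilDeligneRep.deg_geomFrob d.hmul d.huniq d.hex).symm), hchar, hch]

/-! ### Uniqueness of the unramified Frobenius-semisimple parameter (stub H1) -/


end Local

end SatakePlacesAllDataProof

end Summit.Langlands.Langlands.Theorems

end
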